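import Mathlib
import Literature.Computability.AlgebraicComplexity.DetInVP
import Literature.Computability.AlgebraicComplexity.IMMInVPProofs
import Literature.Computability.AlgebraicComplexity.ArithCircuitProofs
import Literature.Computability.AlgebraicComplexity.ValiantClassesProofs
import Summits.ValiantsHypothesis.ValiantsHypothesis.Theorems.DivisionGapTriangularDimersDivisionEasyDefs
import Summits.ValiantsHypothesis.ValiantsHypothesis.Theorems.ZeroOneTransfer.Negative.FalseOfTriangularDimersHard
import Summits.ValiantsHypothesis.ValiantsHypothesis.Theorems.DivisionGapZeroOneTransferStubDimerFamilyVPAux1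
import HarnessLib

/-!
# Crux `DivisionGap.ZeroOneTransfer` (stmt-ValiantsHypothesis-5066), line `charged-uncharged` —
stub `stub_dimerFamilyVP` (B5, the glue of Part B: `D_n ∈ VP_ℂ`)

From (H1) Kasteleyn's determinant identity `det (ε·η·ηᵀ) = (Σ_{fpf involutions} Π η)²` under the
combinatorial Kasteleyn property (stub `stub_kasteleynDetSq`), (H2) the existence of a Kasteleyn
sign function on the rhombus `R_n` of the triangular lattice (conclusion of stub
`stub_rhombusKasteleyn`) and (H3) "square roots are cheap over `ℂ`" (stub `stub_sqrtCheap`), the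
complexified perfect-matching family `D_n` of `R_n` is in `VP_ℂ` — VERBATIM the hypothesis `hVP` of
the route's kill criterion
`Theorems.ZeroOneTransfer.Negative.zeroOneTransfer_false_of_triangularDimers_hard`
(Valiant 1980, §3 Thm. 2; Kasteleyn).  Everything here is bookkeeping over the three inputs.

One level (a finite vertex type `V`, a decidable loop-free adjacency `A`, a skew integer sign
function `ε` supported on `A` with the Kasteleyn property, a base `A`-perfect matching `f₀`;
`D = Σ_f Π_v X (v, f v)` over the `A`-adjacent fixed-point-free involutions `f`, over `ℂ`):
* `det_kasteleyn_eq_sq` — `det (C (ε u v) · η u v · η v u) = D²` for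
  `η u v = if A u v then X (u,v) else 0` (H1 with `R = ℂ[X]`, plus `sum_fpfInvol_prod_ite`);
* `complexity_kasteleyn_det_le` — that determinant costs `≤ 8 (#V+1)⁷ + 2 #V²` (`DET ∈ VP`);
* `eval_base_eq_one` — `D = 1` at the indicator of `f₀`;
* `complexity_dimerSum_le` — `L(D) ≤ (15 (#V+1)⁷)¹² + #V²`: translate to the base point, take the
  cheap square root of `det` (H3), translate back (`complexity_le_of_sq`).
The family (`V = Fin n × Fin n`):
* `adjR_irrefl`, `exists_base_matching` — `AdjR` has no loops; horizontal dominoes for even `n`;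
* `isVPFamily_dimerSum` — `#vars = n⁴`, `deg ≤ n²`, odd levels vanish
  (`dimerVP_filter_fpfInvol_eq_empty_of_odd`), even levels by `complexity_dimerSum_le`;
* `stub_dimerFamilyVP` — the registered signature (`AdjR` = its six disjuncts verbatim; change of
  scalars `ℝ≥0 → ℂ` by `map_sum_prod_X_graph`).
[cite: Valiant1980, §3 Thm. 2]
-/

set_option linter.dupNamespace false

namespace Summit.ValiantsHypothesis.ValiantsHypothesis.Theorems.DivisionGapZeroOneTransfer

open Finset MvPolynomial Literature.Computability.AlgebraicComplexity
open Summit.ValiantsHypothesis.ValiantsHypothesis.Theorems.TriangularDimersDivisionEasy.Shuffling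
  (AdjR)
open Summit.ValiantsHypothesis.ValiantsHypothesis.Theorems.ZeroOneTransfer.Negative
  (map_sum_prod_X_graph)

noncomputable section

namespace DimerFamilyVP

section Level

variable {V : Type} [Fintype V] [DecidableEq V]

/-- Kasteleyn's determinant identity (hypothesis `H1` = stub `stub_kasteleynDetSq`) instantiated
with `R = ℂ[X_{(u,v)}]`, signs `C (ε u v)` and half-weights `η u v = if A u v then X (u, v) else 0`:
`det K = D²`. [cite: Valiant1980, §3 Thm. 2] -/
theorem det_kasteleyn_eq_sq
    (H1 : ∀ (V R : Type) [Fintype V] [DecidableEq V] [CommRing R] (ε η : V → V → R),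
      (∀ u v, ε u v = -ε v u) → (∀ v, ε v v = 0) → (∀ u v, ε u v = 0 → η u v = 0) →
      (∀ σ : Equiv.Perm V, (∀ v, σ v ≠ v) → (∀ v, ε v (σ v) ≠ 0) →
        (∀ c ∈ σ.cycleFactorsFinset, Even c.support.card) →
        ((Equiv.Perm.sign σ : ℤ) : R) * ∏ v, ε v (σ v) = 1) →
      (Matrix.of fun u v => ε u v * η u v * η v u).det =
        (∑ f ∈ (Finset.univ : Finset (V → V)).filter (fun f => ∀ v, f (f v) = v ∧ f v ≠ v),
          ∏ v, η v (f v)) ^ 2)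
    (A : V → V → Prop) [∀ u v, Decidable (A u v)] (hA : ∀ v, ¬ A v v) (ε : V → V → ℤ)
    (hskew : ∀ u v, ε u v = -ε v u) (hiff : ∀ u v, ε u v ≠ 0 ↔ A u v)
    (hkast : ∀ σ : Equiv.Perm V, (∀ v, σ v ≠ v) → (∀ v, ε v (σ v) ≠ 0) →
      (∀ c ∈ σ.cycleFactorsFinset, Even c.support.card) →
      (Equiv.Perm.sign σ : ℤ) * ∏ v, ε v (σ v) = 1) :
    (Matrix.of fun u v => C ((ε u v : ℤ) : ℂ) * (if A u v then (X (u, v) : MvPolynomial (V × V) ℂ)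
      else 0) * (if A v u then (X (v, u) : MvPolynomial (V × V) ℂ) else 0)).det =
      (∑ f ∈ (univ : Finset (V → V)).filter (fun f => ∀ v, f (f v) = v ∧ f v ≠ v ∧ A v (f v)),
        ∏ v, (X (v, f v) : MvPolynomial (V × V) ℂ)) ^ 2 := by
  have h := H1 V (MvPolynomial (V × V) ℂ) (fun u v => C ((ε u v : ℤ) : ℂ))
    (fun u v => if A u v then (X (u, v) : MvPolynomial (V × V) ℂ) else 0) ?_ ?_ ?_ ?_
  · rw [h, sum_fpfInvol_prod_ite A (fun u v => (X (u, v) : MvPolynomial (V × V) ℂ))]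
  · intro u v
    rw [hskew u v, Int.cast_neg, map_neg]
  · intro v
    have h0 : ε v v = 0 := by
      by_contra h0
      exact hA v ((hiff v v).mp h0)
    rw [h0, Int.cast_zero, map_zero]
  · intro u v huv
    have h0 : ε u v = 0 := by
      rw [C_eq_zero, Int.cast_eq_zero] at huv
      exact huv
    have hnA : ¬ A u v := fun hAuv => ((hiff u v).mpr hAuv) h0
    exact if_neg hnA
  · intro σ hσ1 hσ2 hσ3
    have hσ2' : ∀ v, ε v (σ v) ≠ 0 := by
      intro v h0
      apply hσ2 v
      rw [h0, Int.cast_zero, map_zero]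
    have hk := hkast σ hσ1 hσ2' hσ3
    have hprod : ∏ v, C ((ε v (σ v) : ℤ) : ℂ) =
        ((∏ v, ε v (σ v) : ℤ) : MvPolynomial (V × V) ℂ) := by
      rw [Int.cast_prod]
      exact Finset.prod_congr rfl fun v _ => map_intCast C _
    rw [hprod, ← Int.cast_mul, hk, Int.cast_one]

/-- The Kasteleyn matrix has entries of cost `≤ 2`, so `L(det K) ≤ 8 (#V+1)⁷ + 2 #V²`.
[cite: Burgisser2000, Prop. 2.30] -/
theorem complexity_kasteleyn_det_le (A : V → V → Prop) [∀ u v, Decidable (A u v)]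
    (c : V → V → ℂ) :
    complexity (Matrix.of fun u v => C (c u v) * (if A u v then (X (u, v) : MvPolynomial (V × V) ℂ)
      else 0) * (if A v u then (X (v, u) : MvPolynomial (V × V) ℂ) else 0)).det ≤
      8 * (Fintype.card V + 1) ^ 7 + 2 * (Fintype.card V * Fintype.card V) := by
  refine (complexity_det_le _).trans (Nat.add_le_add_left ?_ _)
  calc ∑ q : V × V, complexity ((Matrix.of fun u v => C (c u v) *
          (if A u v then (X (u, v) : MvPolynomial (V × V) ℂ) else 0) *
          (if A v u then (X (v, u) : MvPolynomial (V × V) ℂ) else 0)) q.1 q.2)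
      ≤ ∑ _q : V × V, 2 := Finset.sum_le_sum fun q _ => by
          rw [Matrix.of_apply]
          exact complexity_C_mul_mul_le _ _ _ (complexity_ite_X_zero _ _)
            (complexity_ite_X_zero _ _)
    _ = 2 * (Fintype.card V * Fintype.card V) := by
          simp [Finset.card_univ, Fintype.card_prod, mul_comm]

/-- The perfect-matching polynomial is `1` at the indicator of a base matching `f₀` (only the term
of `f₀` survives). [folklore] -/
theorem eval_base_eq_one (A : V → V → Prop) [∀ u v, Decidable (A u v)] (f₀ : V → V)
    (hf₀ : ∀ v, f₀ (f₀ v) = v ∧ f₀ v ≠ v ∧ A v (f₀ v)) :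
    eval (fun p : V × V => if f₀ p.1 = p.2 then (1 : ℂ) else 0)
      (∑ f ∈ (univ : Finset (V → V)).filter (fun f => ∀ v, f (f v) = v ∧ f v ≠ v ∧ A v (f v)),
        ∏ v, (X (v, f v) : MvPolynomial (V × V) ℂ)) = 1 := by
  rw [map_sum]
  simp_rw [map_prod, eval_X]
  rw [Finset.sum_eq_single f₀]
  · exact Finset.prod_eq_one fun v _ => if_pos rfl
  · intro f _ hne
    obtain ⟨v, hv⟩ : ∃ v, f v ≠ f₀ v := by
      by_contra h
      exact hne (funext fun v => not_not.mp (not_exists.mp h v))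
    exact Finset.prod_eq_zero (Finset.mem_univ v) (if_neg (Ne.symm hv))
  · intro h
    exact absurd (Finset.mem_filter.mpr ⟨Finset.mem_univ _, hf₀⟩) h

/-- `m² ≤ (m+1)⁷` and `m ≤ (m+1)⁷`: absorbing small terms. [folklore] -/
theorem sq_le_succ_pow_seven (m : ℕ) : m * m ≤ (m + 1) ^ 7 ∧ m ≤ (m + 1) ^ 7 := by
  have h1 : m + 1 ≤ (m + 1) ^ 7 := by
    calc m + 1 = (m + 1) ^ 1 := (pow_one _).symm
      _ ≤ (m + 1) ^ 7 := Nat.pow_le_pow_right (Nat.succ_pos m) (by norm_num)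
  have h2 : m * m ≤ (m + 1) ^ 7 := by
    calc m * m ≤ (m + 1) * (m + 1) := Nat.mul_le_mul (Nat.le_succ m) (Nat.le_succ m)
      _ = (m + 1) ^ 2 := (sq _).symm
      _ ≤ (m + 1) ^ 7 := Nat.pow_le_pow_right (Nat.succ_pos m) (by norm_num)
  exact ⟨h2, (Nat.le_succ m).trans h1⟩

/-- **One level of `D ∈ VP`.**  Given Kasteleyn's determinant identity (`H1`) and cheap square
roots (`H3`), an irreflexive adjacency `A` with a Kasteleyn sign function `ε` and a base matching
`f₀`: `L(D) ≤ (15 (#V+1)⁷)¹² + #V²` — translate `D` to the base point (constant coefficient `1`),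
bound `L(D²) = L(det K)` by `DET ∈ VP`, take the square root, translate back.
[cite: Valiant1980, §3 Thm. 2] -/
theorem complexity_dimerSum_le
    (H1 : ∀ (V R : Type) [Fintype V] [DecidableEq V] [CommRing R] (ε η : V → V → R),
      (∀ u v, ε u v = -ε v u) → (∀ v, ε v v = 0) → (∀ u v, ε u v = 0 → η u v = 0) →
      (∀ σ : Equiv.Perm V, (∀ v, σ v ≠ v) → (∀ v, ε v (σ v) ≠ 0) →
        (∀ c ∈ σ.cycleFactorsFinset, Even c.support.card) →
        ((Equiv.Perm.sign σ : ℤ) : R) * ∏ v, ε v (σ v) = 1) →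
      (Matrix.of fun u v => ε u v * η u v * η v u).det =
        (∑ f ∈ (Finset.univ : Finset (V → V)).filter (fun f => ∀ v, f (f v) = v ∧ f v ≠ v),
          ∏ v, η v (f v)) ^ 2)
    (H3 : ∀ (τ : Type) [Fintype τ] (f : MvPolynomial τ ℂ), MvPolynomial.constantCoeff f = 1 →
      complexity f ≤ (complexity (f ^ 2) + f.totalDegree + Fintype.card τ + 2) ^ 12)
    (A : V → V → Prop) [∀ u v, Decidable (A u v)] (hA : ∀ v, ¬ A v v) (ε : V → V → ℤ)
    (hskew : ∀ u v, ε u v = -ε v u) (hiff : ∀ u v, ε u v ≠ 0 ↔ A u v)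
    (hkast : ∀ σ : Equiv.Perm V, (∀ v, σ v ≠ v) → (∀ v, ε v (σ v) ≠ 0) →
      (∀ c ∈ σ.cycleFactorsFinset, Even c.support.card) →
      (Equiv.Perm.sign σ : ℤ) * ∏ v, ε v (σ v) = 1)
    (f₀ : V → V) (hf₀ : ∀ v, f₀ (f₀ v) = v ∧ f₀ v ≠ v ∧ A v (f₀ v)) :
    complexity (∑ f ∈ (univ : Finset (V → V)).filter
        (fun f => ∀ v, f (f v) = v ∧ f v ≠ v ∧ A v (f v)),
        ∏ v, (X (v, f v) : MvPolynomial (V × V) ℂ)) ≤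
      (15 * (Fintype.card V + 1) ^ 7) ^ 12 + Fintype.card V * Fintype.card V := by
  have hdet := det_kasteleyn_eq_sq H1 A hA ε hskew hiff hkast
  have hcK := (congrArg complexity hdet).symm.trans_le
    (complexity_kasteleyn_det_le A fun u v => ((ε u v : ℤ) : ℂ))
  have heval := eval_base_eq_one A f₀ hf₀
  have hdeg := totalDegree_aeval_sum_prod_X_le
    ((univ : Finset (V → V)).filter (fun f => ∀ v, f (f v) = v ∧ f v ≠ v ∧ A v (f v)))
    (fun i : V × V => (X i : MvPolynomial (V × V) ℂ) +
      C ((fun p : V × V => if f₀ p.1 = p.2 then (1 : ℂ) else 0) i))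
    (fun i => totalDegree_X_add_C_le i _)
  have h := complexity_le_of_sq H3 _ _ (Fintype.card V) heval hdeg
  rw [Fintype.card_prod] at h
  refine h.trans ?_
  obtain ⟨hsq, hlin⟩ := sq_le_succ_pow_seven (Fintype.card V)
  have hone : 1 ≤ (Fintype.card V + 1) ^ 7 := Nat.one_le_pow _ _ (Nat.succ_pos _)
  generalize (Fintype.card V + 1) ^ 7 = P at *
  generalize Fintype.card V * Fintype.card V = M at *
  gcongr
  omega

end Level

section Rhombus

/-- The rhombus adjacency has no loops. [folklore] -/
theorem adjR_irrefl {n : ℕ} (v : Fin n × Fin n) : ¬ AdjR v v := by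
  unfold AdjR
  omega

/-- For even `n`, the horizontal dominoes `(2i, j) – (2i+1, j)` form an `AdjR`-adjacent
fixed-point-free involution of the rhombus (a base perfect matching). [folklore] -/
theorem exists_base_matching {n : ℕ} (hn : Even n) :
    ∃ f₀ : Fin n × Fin n → Fin n × Fin n, ∀ v, f₀ (f₀ v) = v ∧ f₀ v ≠ v ∧ AdjR v (f₀ v) := by
  obtain ⟨k, hk⟩ := hn
  refine ⟨fun v => (⟨if v.1.val % 2 = 0 then v.1.val + 1 else v.1.val - 1, ?_⟩, v.2), fun v => ?_⟩
  · have := v.1.isLt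
    split_ifs with h <;> omega
  · obtain ⟨⟨i, hi⟩, j⟩ := v
    refine ⟨?_, ?_, ?_⟩
    · simp only [Prod.mk.injEq, Fin.mk.injEq, and_true]
      split_ifs with h1 h2 h2 <;> omega
    · simp only [ne_eq, Prod.mk.injEq, Fin.mk.injEq, and_true]
      split_ifs with h1 <;> omega
    · unfold AdjR
      simp only [and_true]
      split_ifs with h1 <;> omega

end Rhombus

section Family

/-- **The dimer family is in `VP_ℂ`** for every loop-free adjacency `A n` on `Fin n × Fin n` that
carries a Kasteleyn sign function at every level and a base perfect matching at every even level,
given Kasteleyn's determinant identity (`H1`) and cheap square roots (`H3`): `n⁴` variables, degree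
`≤ n²`, odd levels are `0`, even levels by `complexity_dimerSum_le`.
[cite: Valiant1980, §3 Thm. 2] -/
theorem isVPFamily_dimerSum
    (H1 : ∀ (V R : Type) [Fintype V] [DecidableEq V] [CommRing R] (ε η : V → V → R),
      (∀ u v, ε u v = -ε v u) → (∀ v, ε v v = 0) → (∀ u v, ε u v = 0 → η u v = 0) →
      (∀ σ : Equiv.Perm V, (∀ v, σ v ≠ v) → (∀ v, ε v (σ v) ≠ 0) →
        (∀ c ∈ σ.cycleFactorsFinset, Even c.support.card) →
        ((Equiv.Perm.sign σ : ℤ) : R) * ∏ v, ε v (σ v) = 1) →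
      (Matrix.of fun u v => ε u v * η u v * η v u).det =
        (∑ f ∈ (Finset.univ : Finset (V → V)).filter (fun f => ∀ v, f (f v) = v ∧ f v ≠ v),
          ∏ v, η v (f v)) ^ 2)
    (H3 : ∀ (τ : Type) [Fintype τ] (f : MvPolynomial τ ℂ), MvPolynomial.constantCoeff f = 1 →
      complexity f ≤ (complexity (f ^ 2) + f.totalDegree + Fintype.card τ + 2) ^ 12)
    (A : ∀ n : ℕ, Fin n × Fin n → Fin n × Fin n → Prop) [∀ n u v, Decidable (A n u v)]
    (hA : ∀ n (v : Fin n × Fin n), ¬ A n v v)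
    (H2 : ∀ n : ℕ, ∃ ε : Fin n × Fin n → Fin n × Fin n → ℤ,
      (∀ u v, ε u v = -ε v u) ∧ (∀ u v, ε u v ≠ 0 ↔ A n u v) ∧
      ∀ σ : Equiv.Perm (Fin n × Fin n), (∀ v, σ v ≠ v) → (∀ v, ε v (σ v) ≠ 0) →
        (∀ c ∈ σ.cycleFactorsFinset, Even c.support.card) →
        (Equiv.Perm.sign σ : ℤ) * ∏ v, ε v (σ v) = 1)
    (hbase : ∀ n, Even n → ∃ f₀ : Fin n × Fin n → Fin n × Fin n,
      ∀ v, f₀ (f₀ v) = v ∧ f₀ v ≠ v ∧ A n v (f₀ v)) :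
    IsVPFamily (k := ℂ) fun n => ∑ f ∈ (univ : Finset (Fin n × Fin n → Fin n × Fin n)).filter
        (fun f => ∀ v, f (f v) = v ∧ f v ≠ v ∧ A n v (f v)),
        ∏ v, (X (v, f v) : MvPolynomial ((Fin n × Fin n) × (Fin n × Fin n)) ℂ) := by
  have hsq : IsPBounded fun n : ℕ => n * n := IsPBounded.mul_holds IsPBounded.id IsPBounded.id
  have hcardV : ∀ n, Fintype.card (Fin n × Fin n) = n * n := fun n => by
    rw [Fintype.card_prod, Fintype.card_fin]
  refine ⟨⟨?_, ?_⟩, ?_⟩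
  · refine (IsPBounded.mul_holds hsq hsq).mono fun n => le_of_eq ?_
    simp only [Fintype.card_prod, Fintype.card_fin]
  · refine hsq.mono fun n => ?_
    have h := totalDegree_aeval_sum_prod_X_le (k := ℂ)
      ((univ : Finset (Fin n × Fin n → Fin n × Fin n)).filter
        (fun f => ∀ v, f (f v) = v ∧ f v ≠ v ∧ A n v (f v)))
      X (fun i => (totalDegree_X i).le)
    rw [aeval_X_left_apply, hcardV] at h
    exact h
  · have hbig : IsPBounded fun n : ℕ => (15 * (n * n + 1) ^ 7) ^ 12 + n * n * (n * n) :=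
      IsPBounded.add_holds (IsPBounded.pow_holds (IsPBounded.mul_holds (IsPBounded.const 15)
        (IsPBounded.pow_holds (IsPBounded.add_holds hsq (IsPBounded.const 1)) 7)) 12)
        (IsPBounded.mul_holds hsq hsq)
    refine hbig.mono fun n => ?_
    rcases Nat.even_or_odd n with hn | hn
    · obtain ⟨ε, hskew, hiff, hkast⟩ := H2 n
      obtain ⟨f₀, hf₀⟩ := hbase n hn
      have h := complexity_dimerSum_le H1 H3 (A n) (hA n) ε hskew hiff hkast f₀ hf₀
      rw [hcardV] at h
      exact h
    · have hodd : Odd (Fintype.card (Fin n × Fin n)) := by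
        rw [hcardV]; exact hn.mul hn
      have h0 : complexity (0 : MvPolynomial ((Fin n × Fin n) × (Fin n × Fin n)) ℂ) = 0 := by
        rw [← C_0]; exact complexity_C_holds _
      dsimp only
      rw [dimerVP_filter_fpfInvol_eq_empty_of_odd _ (A n) hodd, Finset.sum_empty, h0]
      exact Nat.zero_le _

end Family

end DimerFamilyVP

/-- **Stub B5 `stub_dimerFamilyVP` (line `charged-uncharged`, crux `DivisionGap.ZeroOneTransfer`).**
From (H1) Kasteleyn's determinant identity, (H2) a Kasteleyn sign function on the triangular
rhombus `R_n` and (H3) cheap square roots over `ℂ`: the complexified perfect-matching family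
`D_n` of `R_n` is in `VP_ℂ` — verbatim the hypothesis `hVP` of
`Theorems.ZeroOneTransfer.Negative.zeroOneTransfer_false_of_triangularDimers_hard`
(Valiant 1980 Thm. 2 / Kasteleyn, as bookkeeping over the three inputs).
[cite: Valiant1980, §3 Thm. 2] -/
theorem stub_dimerFamilyVP :
    (∀ (V R : Type) [Fintype V] [DecidableEq V] [CommRing R] (ε η : V → V → R),
      (∀ u v, ε u v = -ε v u) → (∀ v, ε v v = 0) → (∀ u v, ε u v = 0 → η u v = 0) →
      (∀ σ : Equiv.Perm V, (∀ v, σ v ≠ v) → (∀ v, ε v (σ v) ≠ 0) →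
        (∀ c ∈ σ.cycleFactorsFinset, Even c.support.card) →
        ((Equiv.Perm.sign σ : ℤ) : R) * ∏ v, ε v (σ v) = 1) →
      (Matrix.of fun u v => ε u v * η u v * η v u).det =
        (∑ f ∈ (Finset.univ : Finset (V → V)).filter (fun f => ∀ v, f (f v) = v ∧ f v ≠ v),
          ∏ v, η v (f v)) ^ 2) →
    (∀ n : ℕ, ∃ ε : Fin n × Fin n → Fin n × Fin n → ℤ,
      (∀ u v, ε u v = -ε v u) ∧ (∀ u v, ε u v ≠ 0 ↔ AdjR u v) ∧
      ∀ σ : Equiv.Perm (Fin n × Fin n), (∀ v, σ v ≠ v) → (∀ v, ε v (σ v) ≠ 0) →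
        (∀ c ∈ σ.cycleFactorsFinset, Even c.support.card) →
        (Equiv.Perm.sign σ : ℤ) * ∏ v, ε v (σ v) = 1) →
    (∀ (τ : Type) [Fintype τ] (f : MvPolynomial τ ℂ), MvPolynomial.constantCoeff f = 1 →
      complexity f ≤ (complexity (f ^ 2) + f.totalDegree + Fintype.card τ + 2) ^ 12) →
    IsVPFamily (k := ℂ) fun n => MvPolynomial.map (Complex.ofRealHom.comp NNReal.toRealHom)
      (∑ f ∈ (Finset.univ : Finset (Fin n × Fin n → Fin n × Fin n)).filter (fun f => ∀ v, f (f v) = v ∧ f v ≠ v ∧ (((v.1 : ℕ) + 1 = (f v).1 ∧ (v.2 : ℕ) = (f v).2) ∨ (((f v).1 : ℕ) + 1 = v.1 ∧ (v.2 : ℕ) = (f v).2) ∨ ((v.1 : ℕ) = (f v).1 ∧ (v.2 : ℕ) + 1 = (f v).2) ∨ ((v.1 : ℕ) = (f v).1 ∧ ((f v).2 : ℕ) + 1 = v.2) ∨ ((v.1 : ℕ) + 1 = (f v).1 ∧ ((f v).2 : ℕ) + 1 = v.2) ∨ (((f v).1 : ℕ) + 1 = v.1 ∧ (v.2 : ℕ)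 + 1 = (f v).2))), ∏ v : Fin n × Fin n, (MvPolynomial.X (v, f v) : MvPolynomial ((Fin n × Fin n) × (Fin n × Fin n)) NNReal)) := by
  intro H1 H2 H3
  simp only [map_sum_prod_X_graph]
  exact DimerFamilyVP.isVPFamily_dimerSum H1 H3
    (fun n (v w : Fin n × Fin n) => ((v.1 : ℕ) + 1 = w.1 ∧ (v.2 : ℕ) = w.2) ∨
      (((w.1 : ℕ) + 1 = v.1 ∧ (v.2 : ℕ) = w.2) ∨ ((v.1 : ℕ) = w.1 ∧ (v.2 : ℕ) + 1 = w.2) ∨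
      ((v.1 : ℕ) = w.1 ∧ (w.2 : ℕ) + 1 = v.2) ∨ ((v.1 : ℕ) + 1 = w.1 ∧ (w.2 : ℕ) + 1 = v.2) ∨
      ((w.1 : ℕ) + 1 = v.1 ∧ (v.2 : ℕ) + 1 = w.2)))
    (fun n v => DimerFamilyVP.adjR_irrefl v) H2
    (fun n hn => DimerFamilyVP.exists_base_matching hn)


/-- `stub_dimerFamilyVP` once more, with the implicit scalar field of `IsVPFamily` left to
unification instead of the named argument `(k := ℂ)` and every constant fully qualified — the
form under which this file's sub-goal is registered on the crux item (one-line signature; same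
proposition). [cite: Valiant1980, §3 Thm. 2] -/
theorem dimerVP_isVPFamily_triangularDimers :
    (∀ (V R : Type) [Fintype V] [DecidableEq V] [CommRing R] (ε η : V → V → R), (∀ u v, ε u v = -ε v u) → (∀ v, ε v v = 0) → (∀ u v, ε u v = 0 → η u v = 0) → (∀ σ : Equiv.Perm V, (∀ v, σ v ≠ v) → (∀ v, ε v (σ v) ≠ 0) → (∀ c ∈ σ.cycleFactorsFinset, Even c.support.card) → ((Equiv.Perm.sign σ : ℤ) : R) * ∏ v, ε v (σ v) = 1) → (Matrix.of fun u v => ε u v * η u v * η v u).det = (∑ f ∈ (Finset.univ : Finset (V → V)).filter (fun f => ∀ v, f (f v) = v ∧ f v ≠ v), ∏ v, η v (f v)) ^ 2) → (∀ n : ℕ, ∃ ε : Fin n × Fin n → Fin n × Fin n → ℤ, (∀ u v, ε u v = -ε v u) ∧ (∀ u v, ε u v ≠ 0 ↔ Summit.ValiantsHypothesis.ValiantsHypothesis.Theorems.TriangularDimersDivisionEasy.Shuffling.AdjR u v) ∧ ∀ σ : Equiv.Perm (Fin n × Fin n), (∀ v, σ v ≠ v) → (∀ v, ε v (σ v) ≠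 0) → (∀ c ∈ σ.cycleFactorsFinset, Even c.support.card) → (Equiv.Perm.sign σ : ℤ) * ∏ v, ε v (σ v) = 1) → (∀ (τ : Type) [Fintype τ] (f : MvPolynomial τ ℂ), MvPolynomial.constantCoeff f = 1 → Literature.Computability.AlgebraicComplexity.complexity f ≤ (Literature.Computability.AlgebraicComplexity.complexity (f ^ 2) + f.totalDegree + Fintype.card τ + 2) ^ 12) → Literature.Computability.AlgebraicComplexity.IsVPFamily fun n => MvPolynomial.map (Complex.ofRealHom.comp NNReal.toRealHom) (∑ f ∈ (Finset.univ : Finset (Fin n × Fin n → Fin n × Fin n)).filter (fun f => ∀ v, f (f v) = v ∧ f v ≠ v ∧ (((v.1 : ℕ) + 1 = (f v).1 ∧ (v.2 : ℕ) = (f v).2) ∨ (((f v).1 : ℕ) + 1 = v.1 ∧ (v.2 : ℕ) = (f v).2) ∨ ((v.1 : ℕ) = (f v).1 ∧ (v.2 : ℕ) + 1 = (f v).2) ∨ ((v.1 : ℕ) = (f v).1 ∧ ((f v).2 : ℕ) + 1 = v.2) ∨ ((v.1 : ℕ) + 1 = (f v).1 ∧ ((f v).2 : ℕ) + 1 = v.2)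 ∨ (((f v).1 : ℕ) + 1 = v.1 ∧ (v.2 : ℕ) + 1 = (f v).2))), ∏ v : Fin n × Fin n, (MvPolynomial.X (v, f v) : MvPolynomial ((Fin n × Fin n) × (Fin n × Fin n)) NNReal)) :=
  stub_dimerFamilyVP

end

end Summit.ValiantsHypothesis.ValiantsHypothesis.Theorems.DivisionGapZeroOneTransfer
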